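import Summits.BirchSwinnertonDyer.BirchSwinnertonDyer.Theses.BiquadraticEisensteinDescent
import Literature.NumberTheory.EllipticCurves.BSDSelmerCMPConverse
import Literature.NumberTheory.EllipticCurves.BSDSelmerSmithTwoSelmerRankLaws
import Literature.NumberTheory.EllipticCurves.GlobalMinimalModel

/-!
# Sketch — crux-ideate seat 2 (g9), `stmt-BirchSwinnertonDyer-21381` `HeegnerTwistCouplingInSupply`

First-lemma signatures for the crux idea card `typezero-sieve-switch` (silent-prime Selmer freeze +
sieve switch).  Planner sketch: nothing here is filed as a statement item; nothing is proved here
(crux-ideate files no skeleton).  BSD is not proved by this.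

* `SilentPrimeFreeze` — FIRST LEMMA: for a curve `W/ℚ` with `W[2]` irreducible, twisting `W^{d₁}` by a
  square-free `m > 0` all of whose prime factors `r` are SILENT for `W[2]` (good reduction, `a_r(W)` odd,
  i.e. `Frob_r` is a 3-cycle on `W[2] ∖ 0`, so `H¹(ℚ_r, W[2]) = 0`) and which is a square at `∞, 2` and at
  every prime dividing `N_W · d₁`, does not change the `2`-Selmer group:
  `Sel₂(W^{d₁ m}) = Sel₂(W^{d₁})` inside `H¹(ℚ, W[2])` (stated on Smith's `r_2`).
* `SilentSeedExists` — a Heegner `d₁` with `r_2(W^{d₁}) = 0` exists on every TYPE-S corner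
  (Mazur–Rubin 2010 twisting by pairs of type-1 primes; M-sized support).
* `SilentIndivisible p` — the TRANSFER TARGET (class groups + point counts mod 2 only): some silent-supported
  `m` in the trivial square classes has `p ∤ h(ℚ(√(d₁ m)))`.
* `CruxTypeS` — the crux restricted to `W[2]` irreducible; `CruxOfSilentSwitch` — the assembly shape.
-/

open scoped Classical
open Literature.NumberTheory.EllipticCurves

namespace Summit.BirchSwinnertonDyer.BirchSwinnertonDyer.Cruxes.HeegnerTwistCouplingInSupply.TypezeroSieveSwitch

/-- The crux, by name. -/
abbrev Crux : Prop :=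
  Summit.BirchSwinnertonDyer.BirchSwinnertonDyer.Theses.BiquadraticEisensteinDescent.HeegnerTwistCouplingInSupply

/-- `m` lies in the trivial square class at `∞` (`m > 0`), at `2` (`m ≡ 1 mod 8`) and at every odd prime
`ℓ ∣ N_W · d₁` (`m` a non-zero square mod `ℓ`, hence a square in `ℤ_ℓ^×`). Then `W^{d₁ m} ≅ W^{d₁}` over
`ℚ_v` for every `v ∈ S₀ = {∞, 2} ∪ {ℓ ∣ N_W d₁}`. -/
def InTrivialSquareClasses (W : WeierstrassCurve ℚ) [W.IsElliptic] (d₁ : ℤ) (m : ℕ) : Prop :=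
  0 < m ∧ m % 8 = 1 ∧
    ∀ (ℓ : ℕ), ℓ.Prime → ℓ ≠ 2 → (ℓ : ℤ) ∣ (W.conductorNorm ℤ : ℤ) * d₁ →
      (m : ZMod ℓ) ≠ 0 ∧ IsSquare (m : ZMod ℓ)

/-- `m` is square-free, prime to `2 N_W d₁`, and every prime factor `r` of `m` is SILENT (Mazur–Rubin
type 0) for `W[2]`: `a_r(W)` is odd, i.e. `W̃(𝔽_r)[2] = 0`, i.e. `Frob_r` acts on `W[2] ∖ 0` as a 3-cycle,
so that `H¹(ℚ_r, W[2]) = 0` by the local Euler characteristic formula. (`a_r(W^{d₁}) = ± a_r(W)` has the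
same parity, so the condition is on `W` alone.) -/
def SilentSupported (W : WeierstrassCurve ℚ) [W.IsElliptic] [W.IsGloballyMinimal] (d₁ : ℤ) (m : ℕ) : Prop :=
  Squarefree m ∧ Nat.Coprime m (2 * W.conductorNorm ℤ * d₁.natAbs) ∧
    ∀ (r : ℕ), r.Prime → r ∣ m → Odd (W.frobeniusTrace r)

/-- **FIRST LEMMA — silent-prime freeze.** With `W[2]` irreducible (no rational `2`-torsion, so the
classical `2`-Selmer group is `Sel_{2^∞}[2]` for every twist), the `2`-Selmer rank of `W^{d₁ m}` equals that
of `W^{d₁}` whenever `m` is silent-supported and lies in the trivial square classes at `S₀`: the two Selmer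
groups are the same subgroup of `H¹(ℚ, W[2])` (identical local conditions at `S₀`, unramified conditions
off `S₀ ∪ {r ∣ m}`, and `H¹(ℚ_r, W[2]) = 0` at the silent primes). Elementary given the local-conditions
description of `Sel₂`; Mazur–Rubin, Invent. Math. 181 (2010) §§2–3 (type-0 primes). -/
def SilentPrimeFreeze : Prop :=
  ∀ (W : WeierstrassCurve ℚ) [W.IsElliptic] [W.IsGloballyMinimal] (d₁ : ℤ) (m : ℕ),
    W.HasIrreducibleModPGaloisRep 2 → Squarefree d₁ → d₁ ≠ 0 →
    InTrivialSquareClasses W d₁ m → SilentSupported W d₁ m →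
      twistSelmerTorsionRank W (d₁ * (m : ℤ)) = twistSelmerTorsionRank W d₁

/-- **Seed** (support, M-sized): on a TYPE-S corner there is a Heegner discriminant `d₁` for `N_W`
(`|d₁| > 4`, every `ℓ ∣ N_W` split — in particular the corner prime `p ∣ N_W`) with `r_2(W^{d₁}) = 0`.
Source: Mazur–Rubin, Invent. Math. 181 (2010) Thm 1.4 / Prop. 4.2-type rank-lowering by pairs of type-1
primes in prescribed residue classes, starting from any even-parity Heegner `d₀`. -/
def SilentSeedExists : Prop :=
  ∀ (W : WeierstrassCurve ℚ) [W.IsElliptic] [W.IsGloballyMinimal] (p : ℕ) [Fact p.Prime]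
    [NeZero (W.conductorNorm ℤ)],
    W.HasCM → W.HasIrreducibleModPGaloisRep 2 → W.analyticRank = 1 → ¬ Rank1Residual.Good W p →
    ∃ (d₁ : ℤ) (K : Type) (_ : Field K) (_ : NumberField K), IsImaginaryQuadratic K ∧
      NumberField.discr K = d₁ ∧ 4 < d₁.natAbs ∧ SatisfiesHeegnerHypothesis (W.conductorNorm ℤ) K ∧
      twistSelmerTorsionRank W d₁ = 0

/-- **TRANSFER TARGET `C⁺⁺ = FM_p|silent`.** For a CM curve `W` with `W[2]` irreducible and a square-free
`d₁ < -4`, `d₁ ≡ 1 (mod 8)`: some silent-supported `m > 1` in the trivial square classes gives an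
imaginary quadratic field `ℚ(√(d₁ m))` (discriminant `d₁ m`) with class number prime to `p`.  A statement
about class numbers and point counts mod 2 only — no `L`-function.  Open for `p ≥ 5` (Cohen–Lenstra with
a cubic-Frobenian support condition); its quantitative face is the sieve inequality of the card. -/
def SilentIndivisible (p : ℕ) : Prop :=
  ∀ (W : WeierstrassCurve ℚ) [W.IsElliptic] [W.IsGloballyMinimal] (d₁ : ℤ),
    W.HasCM → W.HasIrreducibleModPGaloisRep 2 → Squarefree d₁ → d₁ < -4 → d₁ % 8 = 1 →
    ∃ (m : ℕ) (K : Type) (_ : Field K) (_ : NumberField K), 1 < m ∧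
      InTrivialSquareClasses W d₁ m ∧ SilentSupported W d₁ m ∧
      IsImaginaryQuadratic K ∧ NumberField.discr K = d₁ * (m : ℤ) ∧ ¬ p ∣ NumberField.classNumber K

/-- The crux restricted to TYPE-S curves (`W[2]` irreducible: `j = 0` with `k` a non-cube, and the CM
discriminants `-11, -19, -27, -43, -67, -163`). -/
def CruxTypeS : Prop :=
  ∀ (W : WeierstrassCurve ℚ) [W.IsElliptic] [W.IsGloballyMinimal] (p : ℕ) [Fact p.Prime]
    [NeZero (W.conductorNorm ℤ)], W.HasIrreducibleModPGaloisRep 2 →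
    W.HasCM → W.analyticRank = 1 → 5 ≤ p → Rank1Residual.CMInert W p → ¬ Rank1Residual.Good W p →
    (∀ B : ℕ, ∃ (K : Type) (_ : Field K) (_ : NumberField K), IsImaginaryQuadratic K ∧
      B < (NumberField.discr K).natAbs ∧ 4 < (NumberField.discr K).natAbs ∧
      SatisfiesHeegnerHypothesis (W.conductorNorm ℤ) K ∧ ¬ p ∣ NumberField.classNumber K) →
    ∃ (K : Type) (_ : Field K) (_ : NumberField K), IsImaginaryQuadratic K ∧
      4 < (NumberField.discr K).natAbs ∧ SatisfiesHeegnerHypothesis (W.conductorNorm ℤ) K ∧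
      (W.quadraticTwist (NumberField.discr K : ℚ)).entireLFunction 1 ≠ 0 ∧
      ¬ p ∣ NumberField.classNumber K

/-- **Assembly shape** (to be proved by a crux-plan skeleton, not here): freeze + seed + Burungale–Tian's
rank-zero `2`-converse for CM curves + the transfer target give the crux on TYPE-S corners.  The remaining
glue (all S-sized, listed on the card): `r_2 = 0 ⇒ Sel_{2^∞}-corank 0`, CM is twist-stable, analytic rank
`0 ⇒ Λ(W^d,1) ≠ 0`, and the Heegner conditions for `d₁ m` from those of `d₁` plus the square classes. -/
def CruxOfSilentSwitch : Prop :=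
  SilentPrimeFreeze → SilentSeedExists →
    burungaleTian_analyticRank_eq_zero_of_selmerCorank_eq_zero_of_hasCM →
    (∀ p : ℕ, 5 ≤ p → SilentIndivisible p) → CruxTypeS

end Summit.BirchSwinnertonDyer.BirchSwinnertonDyer.Cruxes.HeegnerTwistCouplingInSupply.TypezeroSieveSwitch
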